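import Mathlib
import HarnessLib

/-!
# Bilinear forms with Kloosterman fractions: Bettin–Chandee's choice of the amplifier length `L` (§5)

Topic `NumberTheory/LFunctions`.  S. Bettin, V. Chandee, *Trilinear forms with Kloosterman
fractions*, Adv. Math. 328 (2018), §5 "Optimizing the parameter `L`": from (5.1),
`𝓒_b ≪ ‖β‖²M^ε(1+|ϑ|A/(bNM))^{1/2}(AM(bN)^{1/2}L^{-1/2} + AM²/(bLN) + M²/L + b^{3/4}AM^{1/2}N^{5/4}L^{-1/2} + b^{1/2}AL^{3/2}N^{7/4} + b^{1/2}A^{1/2}MN/L)`,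
"We wish to choose `L` so that `b^{1/2}AL^{3/2}N^{7/4} ≈ AM²/(bLN) + M²/L + b^{1/2}A^{1/2}MN/L` and
`L ≥ 2 log(bϑM)`.  So we take `L = M^{4/5}/(b^{3/5}N^{11/10}) + M^{4/5}/(b^{1/5}A^{2/5}N^{7/10}) + M^{2/5}/(A^{1/5}N^{3/10}) + M^ε`.
With this choice (5.1) implies [(5.2)]."  This file PROVES the real-variable inequality behind
this step for `A = 1`, with the last summand of `L` an arbitrary `X ≥ 1` (the source's `M^ε`;
whatever is needed to make `L` admissible), at the cost of the factor `X^{3/2}`: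
`BC_optimise_L`.  (Pure bookkeeping in logarithmic coordinates; the amplified second moment
itself is not touched here.)

## References

* S. Bettin, V. Chandee, Adv. Math. 328 (2018) 1234–1262 (arXiv:1502.00769), §5 ((5.1), (5.2)).
  [BettinChandee2018]
-/

noncomputable section

open Real

namespace Literature.NumberTheory.LFunctions

/-- For nonnegative reals, `max(a, b)^p ≤ a^p + b^p` (`p ≥ 0`). [folklore] -/
theorem DFI_max_rpow_le_add {a b : ℝ} (p : ℝ) (ha : 0 ≤ a) (hb : 0 ≤ b) :
    (max a b) ^ p ≤ a ^ p + b ^ p := by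
  rcases le_total a b with h | h
  · rw [max_eq_right h]
    have : 0 ≤ a ^ p := Real.rpow_nonneg ha p
    linarith
  · rw [max_eq_left h]
    have : 0 ≤ b ^ p := Real.rpow_nonneg hb p
    linarith

/-- **Bettin–Chandee's choice of `L`** (§5, `A = 1`): for `M, N, b > 0`, `X ≥ 1` and
`L = M^{4/5}b^{-3/5}N^{-11/10} + M^{4/5}b^{-1/5}N^{-7/10} + M^{2/5}N^{-3/10} + X`,
`M(bN)^{1/2}L^{-1/2} + M²/(bLN) + M²/L + b^{3/4}M^{1/2}N^{5/4}L^{-1/2} + b^{1/2}L^{3/2}N^{7/4} + b^{1/2}MN/L`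
`≤ 9 X^{3/2} (M(bN)^{1/2} + b^{3/4}M^{1/2}N^{5/4} + M^{6/5}N^{1/10}b^{-2/5} + b^{1/5}M^{6/5}N^{7/10} + b^{1/2}M^{3/5}N^{13/10} + b^{1/2}N^{7/4})`
(each summand of the left is dominated using `L ≥` one summand of `L`; for the increasing term,
`L^{3/2} ≤ 8 max^{3/2}` over the four summands). [cite: BettinChandee2018, §5] -/
theorem BC_optimise_L {M N b X L : ℝ} (hM : 0 < M) (hN : 0 < N) (hb : 0 < b) (hX : 1 ≤ X)
    (hL : L = M ^ (4 / 5 : ℝ) * b ^ (-(3 / 5) : ℝ) * N ^ (-(11 / 10) : ℝ) +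
      M ^ (4 / 5 : ℝ) * b ^ (-(1 / 5) : ℝ) * N ^ (-(7 / 10) : ℝ) + M ^ (2 / 5 : ℝ) * N ^ (-(3 / 10) : ℝ) + X) :
    M * (b * N) ^ (1 / 2 : ℝ) * L ^ (-(1 / 2) : ℝ) + M ^ 2 / (b * L * N) + M ^ 2 / L +
        b ^ (3 / 4 : ℝ) * M ^ (1 / 2 : ℝ) * N ^ (5 / 4 : ℝ) * L ^ (-(1 / 2) : ℝ) +
        b ^ (1 / 2 : ℝ) * L ^ (3 / 2 : ℝ) * N ^ (7 / 4 : ℝ) + b ^ (1 / 2 : ℝ) * M * N / L ≤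
      9 * X ^ (3 / 2 : ℝ) * (M * (b * N) ^ (1 / 2 : ℝ) + b ^ (3 / 4 : ℝ) * M ^ (1 / 2 : ℝ) * N ^ (5 / 4 : ℝ) +
        M ^ (6 / 5 : ℝ) * N ^ (1 / 10 : ℝ) * b ^ (-(2 / 5) : ℝ) + b ^ (1 / 5 : ℝ) * M ^ (6 / 5 : ℝ) * N ^ (7 / 10 : ℝ) +
        b ^ (1 / 2 : ℝ) * M ^ (3 / 5 : ℝ) * N ^ (13 / 10 : ℝ) + b ^ (1 / 2 : ℝ) * N ^ (7 / 4 : ℝ)) := by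
  have hX0 : 0 < X := by linarith
  -- logarithmic coordinates
  obtain ⟨m, hm⟩ : ∃ m : ℝ, m = Real.log M := ⟨_, rfl⟩
  obtain ⟨n, hn⟩ : ∃ n : ℝ, n = Real.log N := ⟨_, rfl⟩
  obtain ⟨l, hl⟩ : ∃ l : ℝ, l = Real.log b := ⟨_, rfl⟩
  have eM : ∀ c : ℝ, M ^ c = Real.exp (c * m) := fun c => by rw [Real.rpow_def_of_pos hM, mul_comm, hm]
  have eN : ∀ c : ℝ, N ^ c = Real.exp (c * n) := fun c => by rw [Real.rpow_def_of_pos hN, mul_comm, hn]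
  have eb : ∀ c : ℝ, b ^ c = Real.exp (c * l) := fun c => by rw [Real.rpow_def_of_pos hb, mul_comm, hl]
  have eM1 : M = Real.exp m := by rw [hm, Real.exp_log hM]
  have eN1 : N = Real.exp n := by rw [hn, Real.exp_log hN]
  have eb1 : b = Real.exp l := by rw [hl, Real.exp_log hb]
  have eM2 : M ^ 2 = Real.exp (2 * m) := by
    rw [eM1, ← Real.exp_nat_mul]; norm_num
  -- the summands of `L`, as exponentials
  obtain ⟨t₁, ht₁⟩ : ∃ t : ℝ, t = Real.exp (4 / 5 * m + -(3 / 5) * l + -(11 / 10) * n) := ⟨_, rfl⟩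
  obtain ⟨t₂, ht₂⟩ : ∃ t : ℝ, t = Real.exp (4 / 5 * m + -(1 / 5) * l + -(7 / 10) * n) := ⟨_, rfl⟩
  obtain ⟨t₃, ht₃⟩ : ∃ t : ℝ, t = Real.exp (2 / 5 * m + -(3 / 10) * n) := ⟨_, rfl⟩
  have ht₁' : M ^ (4 / 5 : ℝ) * b ^ (-(3 / 5) : ℝ) * N ^ (-(11 / 10) : ℝ) = t₁ := by
    rw [ht₁, eM, eb, eN, ← Real.exp_add, ← Real.exp_add]
  have ht₂' : M ^ (4 / 5 : ℝ) * b ^ (-(1 / 5) : ℝ) * N ^ (-(7 / 10) : ℝ) = t₂ := by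
    rw [ht₂, eM, eb, eN, ← Real.exp_add, ← Real.exp_add]
  have ht₃' : M ^ (2 / 5 : ℝ) * N ^ (-(3 / 10) : ℝ) = t₃ := by
    rw [ht₃, eM, eN, ← Real.exp_add]
  have ht₁0 : 0 < t₁ := by rw [ht₁]; exact Real.exp_pos _
  have ht₂0 : 0 < t₂ := by rw [ht₂]; exact Real.exp_pos _
  have ht₃0 : 0 < t₃ := by rw [ht₃]; exact Real.exp_pos _
  rw [ht₁', ht₂', ht₃'] at hL
  have hL1 : t₁ ≤ L := by rw [hL]; linarith
  have hL2 : t₂ ≤ L := by rw [hL]; linarith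
  have hL3 : t₃ ≤ L := by rw [hL]; linarith
  have hLX : X ≤ L := by rw [hL]; linarith
  have hL0 : 0 < L := by linarith
  have hLge1 : 1 ≤ L := hX.trans hLX
  -- the six right-hand terms, as exponentials
  obtain ⟨R₁, hR₁⟩ : ∃ t : ℝ, t = Real.exp (m + (1 / 2 * l + 1 / 2 * n)) := ⟨_, rfl⟩
  obtain ⟨R₂, hR₂⟩ : ∃ t : ℝ, t = Real.exp (3 / 4 * l + 1 / 2 * m + 5 / 4 * n) := ⟨_, rfl⟩
  obtain ⟨R₃, hR₃⟩ : ∃ t : ℝ, t = Real.exp (6 / 5 * m + 1 / 10 * n + -(2 / 5) * l) := ⟨_, rfl⟩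
  obtain ⟨R₄, hR₄⟩ : ∃ t : ℝ, t = Real.exp (1 / 5 * l + 6 / 5 * m + 7 / 10 * n) := ⟨_, rfl⟩
  obtain ⟨R₅, hR₅⟩ : ∃ t : ℝ, t = Real.exp (1 / 2 * l + 3 / 5 * m + 13 / 10 * n) := ⟨_, rfl⟩
  obtain ⟨R₆, hR₆⟩ : ∃ t : ℝ, t = Real.exp (1 / 2 * l + 7 / 4 * n) := ⟨_, rfl⟩
  have hR₁' : M * (b * N) ^ (1 / 2 : ℝ) = R₁ := by
    rw [hR₁, Real.mul_rpow hb.le hN.le, eb, eN, eM1, ← Real.exp_add, ← Real.exp_add]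
  have hR₂' : b ^ (3 / 4 : ℝ) * M ^ (1 / 2 : ℝ) * N ^ (5 / 4 : ℝ) = R₂ := by
    rw [hR₂, eb, eM, eN, ← Real.exp_add, ← Real.exp_add]
  have hR₃' : M ^ (6 / 5 : ℝ) * N ^ (1 / 10 : ℝ) * b ^ (-(2 / 5) : ℝ) = R₃ := by
    rw [hR₃, eM, eN, eb, ← Real.exp_add, ← Real.exp_add]
  have hR₄' : b ^ (1 / 5 : ℝ) * M ^ (6 / 5 : ℝ) * N ^ (7 / 10 : ℝ) = R₄ := by
    rw [hR₄, eb, eM, eN, ← Real.exp_add, ← Real.exp_add]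
  have hR₅' : b ^ (1 / 2 : ℝ) * M ^ (3 / 5 : ℝ) * N ^ (13 / 10 : ℝ) = R₅ := by
    rw [hR₅, eb, eM, eN, ← Real.exp_add, ← Real.exp_add]
  have hR₆' : b ^ (1 / 2 : ℝ) * N ^ (7 / 4 : ℝ) = R₆ := by
    rw [hR₆, eb, eN, ← Real.exp_add]
  rw [hR₁', hR₂', hR₃', hR₄', hR₅', hR₆']
  have hR₁0 : 0 < R₁ := by rw [hR₁]; exact Real.exp_pos _
  have hR₂0 : 0 < R₂ := by rw [hR₂]; exact Real.exp_pos _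
  have hR₃0 : 0 < R₃ := by rw [hR₃]; exact Real.exp_pos _
  have hR₄0 : 0 < R₄ := by rw [hR₄]; exact Real.exp_pos _
  have hR₅0 : 0 < R₅ := by rw [hR₅]; exact Real.exp_pos _
  have hR₆0 : 0 < R₆ := by rw [hR₆]; exact Real.exp_pos _
  have hX32 : 1 ≤ X ^ (3 / 2 : ℝ) := Real.one_le_rpow hX (by norm_num)
  have hb12 : 0 < b ^ (1 / 2 : ℝ) := by positivity
  -- (1), (4): `L^{-1/2} ≤ 1`
  have hLm12 : L ^ (-(1 / 2) : ℝ) ≤ 1 := by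
    rw [Real.rpow_neg hL0.le]
    exact inv_le_one_of_one_le₀ (Real.one_le_rpow hLge1 (by norm_num))
  have b1 : R₁ * L ^ (-(1 / 2) : ℝ) ≤ R₁ := by
    calc R₁ * L ^ (-(1 / 2) : ℝ) ≤ R₁ * 1 := by gcongr
      _ = R₁ := mul_one _
  have b4 : R₂ * L ^ (-(1 / 2) : ℝ) ≤ R₂ := by
    calc R₂ * L ^ (-(1 / 2) : ℝ) ≤ R₂ * 1 := by gcongr
      _ = R₂ := mul_one _
  -- (2) `M²/(bLN) ≤ M²/(b t₁ N) = R₃`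
  have b2 : M ^ 2 / (b * L * N) ≤ R₃ := by
    have h1 : M ^ 2 / (b * L * N) ≤ M ^ 2 / (b * t₁ * N) := by
      apply div_le_div_of_nonneg_left (by positivity) (by positivity)
      gcongr
    have h2 : M ^ 2 / (b * t₁ * N) = R₃ := by
      rw [div_eq_iff (by positivity), eM2, eb1, eN1, ht₁, hR₃, ← Real.exp_add, ← Real.exp_add,
        ← Real.exp_add]
      congr 1; ring
    exact h1.trans h2.le
  -- (3) `M²/L ≤ M²/t₂ = R₄`
  have b3 : M ^ 2 / L ≤ R₄ := by
    have h1 : M ^ 2 / L ≤ M ^ 2 / t₂ := div_le_div_of_nonneg_left (by positivity) ht₂0 hL2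
    have h2 : M ^ 2 / t₂ = R₄ := by
      rw [div_eq_iff ht₂0.ne', eM2, ht₂, hR₄, ← Real.exp_add]
      congr 1; ring
    exact h1.trans h2.le
  -- (6) `b^{1/2} M N / L ≤ b^{1/2} M N / t₃ = R₅`
  have b6 : b ^ (1 / 2 : ℝ) * M * N / L ≤ R₅ := by
    have h1 : b ^ (1 / 2 : ℝ) * M * N / L ≤ b ^ (1 / 2 : ℝ) * M * N / t₃ :=
      div_le_div_of_nonneg_left (by positivity) ht₃0 hL3
    have h2 : b ^ (1 / 2 : ℝ) * M * N / t₃ = R₅ := by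
      rw [div_eq_iff ht₃0.ne', eb, eM1, eN1, ht₃, hR₅, ← Real.exp_add, ← Real.exp_add, ← Real.exp_add]
      congr 1; ring
    exact h1.trans h2.le
  -- (5) `b^{1/2} L^{3/2} N^{7/4} = R₆ L^{3/2} ≤ 8 (R₃ + R₄ + R₅ + X^{3/2} R₆)`
  have b5 : b ^ (1 / 2 : ℝ) * L ^ (3 / 2 : ℝ) * N ^ (7 / 4 : ℝ) ≤ 8 * (R₃ + R₄ + R₅ + X ^ (3 / 2 : ℝ) * R₆) := by
    -- `L ≤ 4 max`, `L^{3/2} ≤ 8 (t₁^{3/2} + t₂^{3/2} + t₃^{3/2} + X^{3/2})`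
    obtain ⟨tm, htm⟩ : ∃ t : ℝ, t = max (max t₁ t₂) (max t₃ X) := ⟨_, rfl⟩
    have e1 : t₁ ≤ tm := by rw [htm]; exact (le_max_left t₁ t₂).trans (le_max_left _ _)
    have e2 : t₂ ≤ tm := by rw [htm]; exact (le_max_right t₁ t₂).trans (le_max_left _ _)
    have e3 : t₃ ≤ tm := by rw [htm]; exact (le_max_left t₃ X).trans (le_max_right _ _)
    have e4 : X ≤ tm := by rw [htm]; exact (le_max_right t₃ X).trans (le_max_right _ _)
    have htm0 : 0 ≤ tm := hX0.le.trans e4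
    have hLtm : L ≤ 4 * tm := by rw [hL]; linarith
    have hL32 : L ^ (3 / 2 : ℝ) ≤ 8 * (t₁ ^ (3 / 2 : ℝ) + t₂ ^ (3 / 2 : ℝ) + t₃ ^ (3 / 2 : ℝ) + X ^ (3 / 2 : ℝ)) := by
      have h1 : L ^ (3 / 2 : ℝ) ≤ (4 * tm) ^ (3 / 2 : ℝ) := Real.rpow_le_rpow hL0.le hLtm (by norm_num)
      have h2 : (4 * tm) ^ (3 / 2 : ℝ) = 8 * tm ^ (3 / 2 : ℝ) := by
        rw [Real.mul_rpow (by norm_num) htm0]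
        congr 1
        rw [show (4 : ℝ) = 2 ^ (2 : ℝ) by norm_num, ← Real.rpow_mul (by norm_num),
          show (2 : ℝ) * (3 / 2) = ((3 : ℕ) : ℝ) by norm_num, Real.rpow_natCast]
        norm_num
      have h3 : tm ^ (3 / 2 : ℝ) ≤ t₁ ^ (3 / 2 : ℝ) + t₂ ^ (3 / 2 : ℝ) + t₃ ^ (3 / 2 : ℝ) + X ^ (3 / 2 : ℝ) := by
        rw [htm]
        calc (max (max t₁ t₂) (max t₃ X)) ^ (3 / 2 : ℝ) ≤ (max t₁ t₂) ^ (3 / 2 : ℝ) + (max t₃ X) ^ (3 / 2 : ℝ) :=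
              DFI_max_rpow_le_add _ (le_max_of_le_left ht₁0.le) (le_max_of_le_left ht₃0.le)
          _ ≤ (t₁ ^ (3 / 2 : ℝ) + t₂ ^ (3 / 2 : ℝ)) + (t₃ ^ (3 / 2 : ℝ) + X ^ (3 / 2 : ℝ)) :=
              add_le_add (DFI_max_rpow_le_add _ ht₁0.le ht₂0.le) (DFI_max_rpow_le_add _ ht₃0.le hX0.le)
          _ = _ := by ring
      calc L ^ (3 / 2 : ℝ) ≤ 8 * tm ^ (3 / 2 : ℝ) := h1.trans h2.le
        _ ≤ _ := by linarith
    -- the monomial identities `R₆ tᵢ^{3/2} = R₃, R₄, R₅`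
    have i1 : R₆ * t₁ ^ (3 / 2 : ℝ) = R₃ := by
      rw [ht₁, ← Real.exp_mul, hR₆, hR₃, ← Real.exp_add]; congr 1; ring
    have i2 : R₆ * t₂ ^ (3 / 2 : ℝ) = R₄ := by
      rw [ht₂, ← Real.exp_mul, hR₆, hR₄, ← Real.exp_add]; congr 1; ring
    have i3 : R₆ * t₃ ^ (3 / 2 : ℝ) = R₅ := by
      rw [ht₃, ← Real.exp_mul, hR₆, hR₅, ← Real.exp_add]; congr 1; ring
    have hbN : b ^ (1 / 2 : ℝ) * N ^ (7 / 4 : ℝ) = R₆ := hR₆'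
    calc b ^ (1 / 2 : ℝ) * L ^ (3 / 2 : ℝ) * N ^ (7 / 4 : ℝ)
        = (b ^ (1 / 2 : ℝ) * N ^ (7 / 4 : ℝ)) * L ^ (3 / 2 : ℝ) := by ring
      _ = R₆ * L ^ (3 / 2 : ℝ) := by rw [hbN]
      _ ≤ R₆ * (8 * (t₁ ^ (3 / 2 : ℝ) + t₂ ^ (3 / 2 : ℝ) + t₃ ^ (3 / 2 : ℝ) + X ^ (3 / 2 : ℝ))) :=
          mul_le_mul_of_nonneg_left hL32 hR₆0.le
      _ = 8 * (R₆ * t₁ ^ (3 / 2 : ℝ) + R₆ * t₂ ^ (3 / 2 : ℝ) + R₆ * t₃ ^ (3 / 2 : ℝ) + X ^ (3 / 2 : ℝ) * R₆) := by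
          ring
      _ = 8 * (R₃ + R₄ + R₅ + X ^ (3 / 2 : ℝ) * R₆) := by rw [i1, i2, i3]
  -- assemble
  have g : ∀ {R : ℝ}, 0 ≤ R → R ≤ X ^ (3 / 2 : ℝ) * R := fun hR => le_mul_of_one_le_left hR hX32
  have g1 := g hR₁0.le; have g2 := g hR₂0.le; have g3 := g hR₃0.le
  have g4 := g hR₄0.le; have g5 := g hR₅0.le; have g6 := g hR₆0.le
  have hX320 : 0 ≤ X ^ (3 / 2 : ℝ) := Real.rpow_nonneg hX0.le _
  have p1 : 0 ≤ X ^ (3 / 2 : ℝ) * R₁ := mul_nonneg hX320 hR₁0.le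
  have p2 : 0 ≤ X ^ (3 / 2 : ℝ) * R₂ := mul_nonneg hX320 hR₂0.le
  have p6 : 0 ≤ X ^ (3 / 2 : ℝ) * R₆ := mul_nonneg hX320 hR₆0.le
  calc R₁ * L ^ (-(1 / 2) : ℝ) + M ^ 2 / (b * L * N) + M ^ 2 / L + R₂ * L ^ (-(1 / 2) : ℝ) +
        b ^ (1 / 2 : ℝ) * L ^ (3 / 2 : ℝ) * N ^ (7 / 4 : ℝ) + b ^ (1 / 2 : ℝ) * M * N / L
      ≤ R₁ + R₃ + R₄ + R₂ + 8 * (R₃ + R₄ + R₅ + X ^ (3 / 2 : ℝ) * R₆) + R₅ := by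
        linarith only [b1, b2, b3, b4, b5, b6]
    _ ≤ 9 * X ^ (3 / 2 : ℝ) * (R₁ + R₂ + R₃ + R₄ + R₅ + R₆) := by
        linarith only [g1, g2, g3, g4, g5, g6, p1, p2, p6]

end Literature.NumberTheory.LFunctions

end
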